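import Literature.Probability.RandomPlanarGeometry.SLEDerivRatioObservable
import Literature.Probability.RandomPlanarGeometry.SLEDerivRatioLimit
import Literature.Probability.RandomPlanarGeometry.CritPercSLESelfTouching
import HarnessLib

/-!
# Rohde–Schramm's Lemma 6.3 for `κ < 8` (proved): `Z(z) < ∞` almost surely

Topic `Probability/RandomPlanarGeometry`; proof sibling of `CritPercSLESwallowing.lean`. We
**discharge the named fact** `Literature.Probability.RandomPlanarGeometry.exists_tendsto_sleDerivRatio_of_lt_eight`
(Rohde–Schramm, *Basic properties of SLE*, Ann. of Math. 161 (2005), **Lemma 6.3**, case `κ < 8`: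
for `0 < κ < 8` and `z ∈ ℍ`, almost surely the ratio `ψₜ = (Im z)|gₜ'(z)|/Im gₜ(z)` has a finite
limit as `t ↑ τ(z)`), `exists_tendsto_sleDerivRatio_of_lt_eight_holds`, and record its
consequences for the SLE_κ trace.

Proof (Rohde–Schramm's proof of Lemma 6.3, pp. 904–905, with the hypergeometric `Ĝ` replaced by
the elementary supersolution `G = 1 + (1+w²)^{-β}` of `SLEDerivRatioSupersolution.lean`): by
`integral_slePointRatioPow_le` (`SLEDerivRatioObservable.lean`), `E[ψ_{ρₙ}^a] ≤ 2` for the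
localizing stopping times `ρₙ ↑ τ(z)` of `SLEPointFlow.lean` and `a = a(κ) > 0`; the sequence
`ψ_{ρₙ}^a` is non-decreasing (`ψ` is non-decreasing in `t`, (6.3)), so by monotone convergence
`E[supₙ ψ_{ρₙ}^a] ≤ 2`, hence a.s. `supₙ ψ_{ρₙ} < ∞`; every `t < τ(z)` is `≤ ρₙ` for `n` large
(`exists_le_slePointLocTime`), so a.s. `ψ` is bounded on `[0, τ(z))`, and being non-decreasing it
converges to a finite limit (`tendsto_sleDerivRatio_atTop_or_exists_tendsto`, the deterministic
dichotomy of `SLEDerivRatioLimit.lean`). ("Since `Ĝ(ẑ) = M₀ = E[M_{t∧tₙ}]` … we immediately get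
`G(ẑ) = E[Z^a] < ∞`", p. 905.)

Consequences (unconditional now, for `0 < κ < 8`): a fixed point of `ℍ` is a.s. not on the SLE_κ
trace (`ae_notMem_range_sleTrace_of_lt_eight`, the interior-point half of Rohde–Schramm's
Thm 6.4 via `CritPercSLESelfTouching.ae_notMem_range_sleTrace_of_lemma63`), and the trace a.s.
has range with empty interior (`ae_interior_range_sleTrace_eq_empty_of_lt_eight`); the
self-touching phase `ae_isSelfTouching_sleTrace` is thereby reduced to the single named fact
`ae_not_injective_sleTrace` (`ae_isSelfTouching_sleTrace_of_not_injective`).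

## References

* S. Rohde, O. Schramm, *Basic properties of SLE*, Ann. of Math. 161 (2005) 883–924: Lemma 6.3
  and its proof (pp. 903–905), Thm 6.4 (p. 906) and its proof (p. 908).
-/

noncomputable section

open Set Filter MeasureTheory Metric Complex
open _root_.Topology
open UpperHalfPlane (upperHalfPlaneSet)
open scoped NNReal ENNReal

namespace Literature.Probability.RandomPlanarGeometry

open Loewner Literature.Probability.Process Literature.Analysis.FunctionSpaces

variable {κ : ℝ≥0} {z : ℂ}

/-! ### The sequence `ψ_{ρₙ}^a` -/

/-- `sleDerivRatio` is `Loewner.derivRatio` of the SLE_κ driving function. [folklore] -/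
theorem sleDerivRatio_eq_derivRatio (κ : ℝ≥0) (ω : ℝ≥0 → ℝ) (z : ℂ) (t : ℝ≥0) :
    sleDerivRatio κ ω z t = derivRatio (sleDriving κ ω) z t := rfl

/-- At time `n + 1 ≥ ρₙ` the stopped clock is `ρₙ`. [folklore] -/
theorem slePointClock_succ_eq (n : ℕ) (ω : ℝ≥0 → ℝ) :
    ((min ((((n : ℝ≥0) + 1 : ℝ≥0)) : WithTop ℝ≥0) (slePointLocTime κ z n ω)).untopA : ℝ≥0) =
      (slePointLocTime κ z n ω).untopA := by
  rw [min_eq_right (slePointLocTime_le n ω)]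

/-- `↑(ρₙ.untopA) = ρₙ` (`ρₙ` is finite). [folklore] -/
theorem coe_untopA_slePointLocTime (n : ℕ) (ω : ℝ≥0 → ℝ) :
    (((slePointLocTime κ z n ω).untopA : ℝ≥0) : WithTop ℝ≥0) = slePointLocTime κ z n ω := by
  rw [WithTop.untopA_eq_untop (slePointLocTime_ne_top n ω), WithTop.coe_untop]

/-- **`ψ_{ρₙ}^a` as the value of `slePointRatioPow` at time `n+1`.** [folklore] -/
theorem slePointRatioPow_succ_eq (hz : 0 < z.im) (a : ℝ) (n : ℕ) (ω : ℝ≥0 → ℝ) :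
    slePointRatioPow κ z n a ((n : ℝ≥0) + 1) ω =
      derivRatio (sleDriving κ ω) z ((slePointLocTime κ z n ω).untopA) ^ a := by
  rw [slePointRatioPow_eq_rpow hz, slePointClock_succ_eq]

/-- `1 ≤ ψ_{ρₙ}`. [folklore] -/
theorem one_le_derivRatio_locTime (hz : 0 < z.im) (n : ℕ) (ω : ℝ≥0 → ℝ) :
    1 ≤ derivRatio (sleDriving κ ω) z ((slePointLocTime κ z n ω).untopA) := by
  refine one_le_derivRatio (continuous_sleDriving κ ω) hz ?_
  rw [coe_untopA_slePointLocTime]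
  exact slePointLocTime_lt_swallowingTime hz n ω

/-- **Monotonicity of `ψ_{ρₙ}^a` in `n`** (`a ≥ 0`): `ρₙ` is non-decreasing and `ψ` is
non-decreasing before `τ(z)` ((6.3)). [cite: RohdeSchramm2005, eq. (6.3)] -/
theorem monotone_slePointRatioPow_succ (hz : 0 < z.im) {a : ℝ} (ha : 0 ≤ a) (ω : ℝ≥0 → ℝ) :
    Monotone fun n : ℕ ↦ slePointRatioPow κ z n a ((n : ℝ≥0) + 1) ω := by
  intro m n hmn
  simp only [slePointRatioPow_succ_eq hz]
  have hρ : slePointLocTime κ z m ω ≤ slePointLocTime κ z n ω := slePointLocTime_mono hz ω hmn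
  have hle : (slePointLocTime κ z m ω).untopA ≤ (slePointLocTime κ z n ω).untopA := by
    rw [← WithTop.coe_le_coe, coe_untopA_slePointLocTime, coe_untopA_slePointLocTime]
    exact hρ
  refine Real.rpow_le_rpow (zero_le_one.trans (one_le_derivRatio_locTime hz m ω)) ?_ ha
  refine derivRatio_mono (continuous_sleDriving κ ω) hz hle ?_
  rw [coe_untopA_slePointLocTime]
  exact slePointLocTime_lt_swallowingTime hz n ω

/-- `ψ_{ρₙ}^a` is measurable. [folklore] -/
theorem measurable_slePointRatioPow_succ (κ : ℝ≥0) (hz : 0 < z.im) (a : ℝ) (n : ℕ) :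
    Measurable fun ω ↦ slePointRatioPow κ z n a ((n : ℝ≥0) + 1) ω :=
  ((stronglyAdapted_slePointRatioPow κ hz n a ((n : ℝ≥0) + 1)).mono (brownianFiltration.le _)).measurable

/-- **`∫⁻ ψ_{ρₙ}^a ≤ 2`** (`a = rsSuperExp κ`, `κ < 8`). [cite: RohdeSchramm2005, Lemma 6.3] -/
theorem lintegral_slePointRatioPow_succ_le (hκ8 : κ < 8) (hz : 0 < z.im) (n : ℕ) :
    ∫⁻ ω, ENNReal.ofReal (slePointRatioPow κ z n (rsSuperExp κ) ((n : ℝ≥0) + 1) ω) ∂preWienerMeasure ≤ 2 := by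
  haveI := isProbabilityMeasure_preWienerMeasure'
  have hint : Integrable (slePointRatioPow κ z n (rsSuperExp κ) ((n : ℝ≥0) + 1)) preWienerMeasure := by
    refine Integrable.of_bound (measurable_slePointRatioPow_succ κ hz _ n).aestronglyMeasurable
      (Real.exp (rsSuperExp κ * (4 * ((n + 2) / z.im) ^ 2 * (n + 1)))) (ae_of_all _ fun ω ↦ ?_)
    rw [Real.norm_eq_abs]
    exact abs_slePointRatioPow_le hκ8.le hz _ ω
  rw [← ofReal_integral_eq_lintegral_ofReal hint (ae_of_all _ fun ω ↦ (slePointRatioPow_pos _ _ _).le)]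
  have h := integral_slePointRatioPow_le hκ8 hz n ((n : ℝ≥0) + 1) (z := z)
  calc ENNReal.ofReal (∫ ω, slePointRatioPow κ z n (rsSuperExp κ) ((n : ℝ≥0) + 1) ω ∂preWienerMeasure)
      ≤ ENNReal.ofReal 2 := ENNReal.ofReal_le_ofReal h
    _ = 2 := by simp

/-! ### A.s. boundedness of `ψ` on `[0, τ(z))` and Lemma 6.3 (`κ < 8`) -/

/-- **Almost surely `ψ` is bounded on `[0, τ(z))`** (`0 < κ < 8`, `z ∈ ℍ`): by monotone
convergence `E[supₙ ψ_{ρₙ}^a] ≤ 2`, so a.s. `supₙ ψ_{ρₙ}^a < ∞`, and every `t < τ(z)` is `≤ ρₙ` for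
some `n` (`exists_le_slePointLocTime`). [cite: RohdeSchramm2005, Lemma 6.3] -/
theorem ae_exists_sleDerivRatio_le (hκ0 : 0 < κ) (hκ8 : κ < 8) (hz : 0 < z.im) :
    ∀ᵐ ω ∂preWienerMeasure, ∃ C : ℝ, ∀ t : ℝ≥0,
      (t : WithTop ℝ≥0) < swallowingTime (sleDriving κ ω) z → sleDerivRatio κ ω z t ≤ C := by
  set a : ℝ := rsSuperExp κ with ha
  have ha0 : 0 < a := rsSuperExp_pos (by exact_mod_cast hκ0) (by exact_mod_cast hκ8)
  set F : ℕ → (ℝ≥0 → ℝ) → ℝ≥0∞ := fun n ω ↦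
    ENNReal.ofReal (slePointRatioPow κ z n a ((n : ℝ≥0) + 1) ω) with hF
  have hFm : ∀ n, Measurable (F n) := fun n ↦
    (measurable_slePointRatioPow_succ κ hz a n).ennreal_ofReal
  have hFmono : Monotone F := fun m n hmn ω ↦
    ENNReal.ofReal_le_ofReal (monotone_slePointRatioPow_succ hz ha0.le ω hmn)
  have hsup : ∫⁻ ω, (⨆ n, F n ω) ∂preWienerMeasure ≤ 2 := by
    rw [lintegral_iSup hFm hFmono]
    exact iSup_le fun n ↦ lintegral_slePointRatioPow_succ_le hκ8 hz n
  have hlt : ∀ᵐ ω ∂preWienerMeasure, (⨆ n, F n ω) < ∞ :=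
    ae_lt_top (Measurable.iSup hFm) (ne_top_of_le_ne_top (by simp) hsup)
  filter_upwards [hlt] with ω hω
  set S : ℝ≥0∞ := ⨆ n, F n ω with hS
  -- `ψ_{ρₙ} ≤ C := S.toReal ^ (1/a)` for all `n`
  have hbound : ∀ n, derivRatio (sleDriving κ ω) z ((slePointLocTime κ z n ω).untopA) ≤
      S.toReal ^ (1 / a) := by
    intro n
    have h1 : slePointRatioPow κ z n a ((n : ℝ≥0) + 1) ω ≤ S.toReal := by
      have : F n ω ≤ S := le_iSup (fun n ↦ F n ω) n
      rw [hF] at this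
      exact (ENNReal.ofReal_le_iff_le_toReal hω.ne).1 this
    rw [slePointRatioPow_succ_eq hz] at h1
    have hψ := one_le_derivRatio_locTime hz n ω (κ := κ)
    have h2 := Real.rpow_le_rpow (Real.rpow_nonneg (zero_le_one.trans hψ) a) h1
      (one_div_nonneg.2 ha0.le)
    rwa [← Real.rpow_mul (zero_le_one.trans hψ), mul_one_div_cancel ha0.ne', Real.rpow_one] at h2
  refine ⟨S.toReal ^ (1 / a), fun t ht ↦ ?_⟩
  obtain ⟨N, hN⟩ := exists_le_slePointLocTime hz ω ht
  have htρ : t ≤ (slePointLocTime κ z N ω).untopA := by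
    rw [← WithTop.coe_le_coe, coe_untopA_slePointLocTime]
    exact hN N le_rfl
  calc sleDerivRatio κ ω z t = derivRatio (sleDriving κ ω) z t := rfl
    _ ≤ derivRatio (sleDriving κ ω) z ((slePointLocTime κ z N ω).untopA) := by
        refine derivRatio_mono (continuous_sleDriving κ ω) hz htρ ?_
        rw [coe_untopA_slePointLocTime]
        exact slePointLocTime_lt_swallowingTime hz N ω
    _ ≤ S.toReal ^ (1 / a) := hbound N

/-- **Rohde–Schramm (2005), Lemma 6.3, case `κ < 8` (proved)**: discharge of the named fact
`exists_tendsto_sleDerivRatio_of_lt_eight` — for `0 < κ < 8` and `z ∈ ℍ`, almost surely the ratio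
`(Im z)|gₜ'(z)|/Im gₜ(z)` converges to a finite limit as `t ↑ τ(z)`. The ratio is non-decreasing,
so it tends to `∞` or to a finite limit (`tendsto_sleDerivRatio_atTop_or_exists_tendsto`); the
first alternative is excluded a.s. by `ae_exists_sleDerivRatio_le`. [cite: RohdeSchramm2005, Lemma 6.3] -/
theorem exists_tendsto_sleDerivRatio_of_lt_eight_holds : exists_tendsto_sleDerivRatio_of_lt_eight := by
  intro κ hκ0 hκ8 z hz
  have hzim : 0 < z.im := hz
  filter_upwards [ae_exists_sleDerivRatio_le hκ0 hκ8 hzim] with ω hω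
  obtain ⟨C, hC⟩ := hω
  rcases tendsto_sleDerivRatio_atTop_or_exists_tendsto κ ω hz with h | ⟨L, -, hL⟩
  · exfalso
    have hzW : z ≠ sleDriving κ ω 0 := ne_driving_of_im_pos hzim 0
    have h0 : ((0 : ℝ≥0) : WithTop ℝ≥0) < swallowingTime (sleDriving κ ω) z :=
      swallowingTime_pos_holds (continuous_sleDriving κ ω) hzW
    haveI : Nonempty {t : ℝ≥0 // (t : WithTop ℝ≥0) < swallowingTime (sleDriving κ ω) z} := ⟨⟨0, h0⟩⟩
    obtain ⟨t, ht⟩ := (h.eventually_gt_atTop C).exists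
    exact absurd (hC t.1 t.2) (not_le.2 ht)
  · exact ⟨L, hL⟩

/-! ### Consequences for the SLE_κ trace, `0 < κ < 8` -/

/-- **A fixed point of `ℍ` is a.s. not on the SLE_κ trace, `0 < κ < 8`** — the interior-point half
of Rohde–Schramm's Thm 6.4, now unconditional (`ae_notMem_range_sleTrace_of_lemma63` with
`exists_tendsto_sleDerivRatio_of_lt_eight_holds`). [cite: RohdeSchramm2005, Thm 6.4] -/
theorem ae_notMem_range_sleTrace_of_lt_eight (hκ0 : 0 < κ) (hκ8 : κ < 8) (hz : 0 < z.im) :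
    ∀ᵐ ω ∂preWienerMeasure, z ∉ range (sleTrace κ ω) :=
  ae_notMem_range_sleTrace_of_lemma63 exists_tendsto_sleDerivRatio_of_lt_eight_holds hκ0 hκ8 hz

/-- **The SLE_κ trace a.s. has range with empty interior, `0 < κ < 8`** (unconditional).
[cite: RohdeSchramm2005, §1 p. 885 and Lemma 6.3] -/
theorem ae_interior_range_sleTrace_eq_empty_of_lt_eight (hκ0 : 0 < κ) (hκ8 : κ < 8) :
    ∀ᵐ ω ∂preWienerMeasure, interior (range (sleTrace κ ω)) = ∅ :=
  ae_interior_range_sleTrace_eq_empty_of_lemma63 exists_tendsto_sleDerivRatio_of_lt_eight_holds hκ0 hκ8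

/-- **The self-touching phase reduced to non-injectivity alone**: `ae_isSelfTouching_sleTrace`
(crit-perc.S20, `4 < κ < 8`) follows from the single named fact `ae_not_injective_sleTrace`
(Rohde–Schramm §1, "for `κ ∈ (4, 8)` the path `γ` is not a simple path").
[cite: RohdeSchramm2005, §1 p. 885 and Thm 6.4] -/
theorem ae_isSelfTouching_sleTrace_of_not_injective (hA : ae_not_injective_sleTrace) :
    ae_isSelfTouching_sleTrace (κ := κ) :=
  ae_isSelfTouching_sleTrace_of_lemma63 hA exists_tendsto_sleDerivRatio_of_lt_eight_holds

end Literature.Probability.RandomPlanarGeometry
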